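import Literature.Probability.RandomPlanarGeometry.ChordalCapacityDivergence
import Literature.Probability.RandomPlanarGeometry.JordanDomainProofs
import Literature.Probability.RandomPlanarGeometry.ConformalMapProofs
import Literature.Analysis.Complex.SchwarzReflection
import Mathlib.Analysis.Complex.BranchLogRoot
import HarnessLib

/-!
# Crux `SAWDevelopingMap.ObservableToSLE` (stmt-CriticalPhenomena-10472), line
`floor-ratio-restriction-bootstrap`: conformal data of a Dobrushin domain for the mechanism stub
`stub_restrictionCocycle`

Landing target:
`Summits/CriticalPhenomena/SAWScalingLimit/Theorems/SAWDevelopingMapObservableToSLERestrictionCocycleHelpersReflection.lean`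
(`--supports stmt-CriticalPhenomena-10472`).

The target `HexObservableLimit` is normalised by a conformal map `Φ : Ω → ℍ` with `Φ(a) = ∞`,
`Φ(b) = 0`, a continuous logarithm `L` of `Φ'` and the boundary limits of `L` at the flat marked
points.  This file constructs these data from a chordal uniformizing map `ψ : (ℍ; 0, ∞) → (Ω; a, b)`:

* `exists_inversion` — the inversion `z ↦ -1/z` as a conformal automorphism of `ℍ`;
* `exists_halfPlaneMap` — `Ψ = -1/ψ⁻¹ : Ω → ℍ` is a conformal equivalence with `‖Ψ‖ → ∞` at `a`,
  `Ψ → 0` at `b`, and a REAL boundary value at every boundary point other than `a` (Carathéodory's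
  boundary correspondence, `IsChordalUniformizing.exists_tendsto_symm_of_mem_frontier`);
* `exists_log_of_isSimplyConnected`, `exists_log_deriv` — continuous logarithms (of the derivative
  of a conformal map of a Jordan domain);
* **`exists_tendsto_log_deriv_of_flat`** — at a flat boundary point `x` of an open set `U`
  (`U ∩ B(x, r)` is the upper half-disc) where the conformal map `Ψ : U → ℍ` has real boundary values
  along the diameter, every continuous logarithm `L` of `Ψ'` has a limit at `x` from inside `U`:
  `Ψ` extends continuously and with real values to the diameter, hence holomorphically to the disc
  by the Schwarz reflection principle (`Complex.differentiableOn_schwarzReflection`), the extension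
  has non-vanishing derivative at `x` (`SchwarzReflection.deriv_ne_zero_of_im_pos`), and `L` differs
  from a continuous logarithm of the extended derivative by a constant on the (connected) half-disc.
-/

noncomputable section

open scoped Topology Real
open Filter Set Metric Complex Bornology
open Literature.Probability.RandomPlanarGeometry
open UpperHalfPlane (upperHalfPlaneSet isOpen_upperHalfPlaneSet)

namespace Summit.CriticalPhenomena.SAWScalingLimit.Theorems.ObservableToSLE.FloorRatio

/-! ### The inversion of the half-plane -/

/-- **The inversion `z ↦ -1/z` is a conformal automorphism of `ℍ`** (an involution:
`im (-1/z) = im z/|z|² > 0`). Ahlfors, *Complex Analysis* (1979), Ch. 3 §3. [folklore] -/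
theorem exists_inversion : ∃ J : ConformalEquiv upperHalfPlaneSet upperHalfPlaneSet,
    (∀ z, J z = -z⁻¹) ∧ ∀ z, J.symm z = -z⁻¹ := by
  have him : ∀ z : ℂ, 0 < z.im → 0 < (-z⁻¹).im := by
    intro z hz
    rw [neg_im, inv_im, neg_div, neg_neg]
    exact div_pos hz (Complex.normSq_pos.2 (by rintro rfl; simp at hz))
  have hinv : ∀ z : ℂ, -(-z⁻¹)⁻¹ = z := fun z ↦ by rw [inv_neg, inv_inv, neg_neg]
  have hdiff : DifferentiableOn ℂ (fun z : ℂ ↦ -z⁻¹) upperHalfPlaneSet := by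
    refine (differentiableOn_inv.mono ?_).neg
    rintro z hz rfl
    exact absurd hz (by simp [upperHalfPlaneSet])
  refine ⟨{ toFun := fun z ↦ -z⁻¹
            invFun := fun z ↦ -z⁻¹
            source := upperHalfPlaneSet
            target := upperHalfPlaneSet
            map_source' := fun z hz ↦ him z hz
            map_target' := fun z hz ↦ him z hz
            left_inv' := fun z _ ↦ hinv z
            right_inv' := fun z _ ↦ hinv z
            source_eq := rfl
            target_eq := rfl
            differentiableOn := hdiff
            differentiableOn_symm := hdiff }, fun z ↦ rfl, fun z ↦ rfl⟩

/-! ### The half-plane map `Ψ = -1/ψ⁻¹` of a Dobrushin domain -/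

/-- **The conformal map `Ψ = -1/ψ⁻¹ : (Ω; a, b) → (ℍ; ∞, 0)`.**  For a chordal uniformizing map
`ψ : (ℍ; 0, ∞) → (Ω; a, b)` of a Dobrushin domain, `Ψ = -1/ψ⁻¹` is a conformal equivalence
`Ω → ℍ` with `‖Ψ‖ → ∞` at `a`, boundary value `0` at `b`, and a real boundary value at every
boundary point other than `a` (the boundary correspondence of Carathéodory's theorem is a bijection
`ℝ ∪ {∞} → ∂Ω` with `0 ↦ a`, `∞ ↦ b`). Pommerenke, *Boundary Behaviour of Conformal Maps* (1992),
Thm. 2.6; Lawler (2005), §6.1. [cite: PommerenkeBBCM1992, Thm. 2.6] -/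
theorem exists_halfPlaneMap (E : DobrushinDomain) (ψ : ConformalEquiv upperHalfPlaneSet E.carrier)
    (hψ : E.IsChordalUniformizing ψ) :
    ∃ Ψ : ConformalEquiv E.carrier upperHalfPlaneSet, (∀ z, Ψ z = -(ψ.symm z)⁻¹) ∧
      Tendsto (fun z => ‖Ψ z‖) (𝓝[E.carrier] (E.pt 0)) atTop ∧
      Ψ.HasBoundaryValue (E.pt 1) 0 ∧
      ∀ p ∈ frontier E.carrier, p ≠ E.pt 0 → ∃ σ : ℝ, Ψ.HasBoundaryValue p σ := by
  obtain ⟨J, hJ, -⟩ := exists_inversion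
  refine ⟨ψ.symm.trans J, fun z => by rw [ConformalEquiv.trans_apply, hJ], ?_, ?_, ?_⟩
  · -- `‖Ψ‖ → ∞` at `a`: `ψ⁻¹ → 0` there
    have h0 : Tendsto ψ.symm (𝓝[E.carrier] (E.pt 0)) (𝓝[≠] 0) := by
      refine tendsto_nhdsWithin_iff.2 ⟨hψ.tendsto_symm_nhds_zero, ?_⟩
      filter_upwards [self_mem_nhdsWithin] with z hz
      intro h
      have : (0 : ℂ) ∈ upperHalfPlaneSet := by rw [← (h : ψ.symm z = 0)]; exact ψ.symm_mapsTo hz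
      exact absurd this (by simp [upperHalfPlaneSet])
    have h1 := (tendsto_norm_cobounded_atTop.comp (tendsto_inv₀_nhdsNE_zero.comp h0))
    refine h1.congr fun z => ?_
    simp only [Function.comp_apply, ConformalEquiv.trans_apply, hJ, norm_neg]
  · -- `Ψ → 0` at `b`: `ψ⁻¹ → ∞` there
    have h0 : Tendsto ψ.symm (𝓝[E.carrier] (E.pt 1)) (cobounded ℂ) := by
      rw [cobounded_eq_cocompact]; exact hψ.tendsto_symm_cocompact
    have h1 := (tendsto_inv₀_cobounded.comp h0).neg
    rw [neg_zero] at h1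
    refine h1.congr fun z => ?_
    simp only [Function.comp_apply, ConformalEquiv.trans_apply, hJ]
  · intro p hp hpa
    by_cases hpb : p = E.pt 1
    · subst hpb
      refine ⟨0, ?_⟩
      have h0 : Tendsto ψ.symm (𝓝[E.carrier] (E.pt 1)) (cobounded ℂ) := by
        rw [cobounded_eq_cocompact]; exact hψ.tendsto_symm_cocompact
      have h1 := (tendsto_inv₀_cobounded.comp h0).neg
      rw [neg_zero] at h1
      refine (h1.congr fun z => ?_).trans (by simp)
      simp only [Function.comp_apply, ConformalEquiv.trans_apply, hJ]
    · obtain ⟨q, hq, hψq⟩ := hψ.exists_tendsto_symm_of_mem_frontier hp hpa hpb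
      refine ⟨-q⁻¹, ?_⟩
      have hq' : (q : ℂ) ≠ 0 := by exact_mod_cast hq
      have h1 := ((continuousAt_inv₀ hq').tendsto.comp hψq).neg
      have hcast : (((-q⁻¹ : ℝ)) : ℂ) = -(q : ℂ)⁻¹ := by push_cast; ring
      rw [ConformalEquiv.HasBoundaryValue, hcast]
      refine h1.congr fun z => ?_
      simp only [Function.comp_apply, ConformalEquiv.trans_apply, hJ]

/-! ### Continuous logarithms -/

/-- An open ball of `ℂ` is simply connected (it is convex). [folklore] -/
theorem isSimplyConnected_ball (c : ℂ) {r : ℝ} (hr : 0 < r) : IsSimplyConnected (ball c r) := by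
  have : ContractibleSpace (ball c r) := (convex_ball c r).contractibleSpace ⟨c, mem_ball_self hr⟩
  change SimplyConnectedSpace (ball c r)
  infer_instance

/-- **A continuous logarithm of a nowhere-vanishing continuous function on a simply connected open
set** (Mathlib's `Complex.exists_continuousOn_eqOn_exp_comp`). [folklore] -/
theorem exists_log_of_isSimplyConnected {U : Set ℂ} (hU : IsOpen U) (hsc : IsSimplyConnected U)
    {g : ℂ → ℂ} (hg : ContinuousOn g U) (hg0 : ∀ z ∈ U, g z ≠ 0) :
    ∃ L : ℂ → ℂ, ContinuousOn L U ∧ ∀ z ∈ U, exp (L z) = g z := by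
  obtain ⟨L, hL, hLe⟩ := Complex.exists_continuousOn_eqOn_exp_comp hsc hU hg (by
    rintro ⟨z, hz, h0⟩
    exact hg0 z hz h0)
  exact ⟨L, hL, fun z hz ↦ hLe hz⟩

/-- **The derivative of a conformal map of a Jordan domain has a continuous logarithm**: the
derivative is holomorphic and nowhere zero on the simply connected carrier. Ahlfors, *Complex
Analysis* (1979), Ch. 4 §3.3 Cor. 2 and Ch. 6 §1.1. [folklore] -/
theorem exists_log_deriv (E : JordanDomain) {V : Set ℂ} (Ψ : ConformalEquiv E.carrier V) :
    ∃ L : ℂ → ℂ, ContinuousOn L E.carrier ∧ ∀ z ∈ E.carrier, exp (L z) = deriv Ψ z := by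
  have hd : DifferentiableOn ℂ (deriv Ψ) E.carrier :=
    ((Ψ.differentiableOn_coe.analyticOnNhd E.isOpen).deriv).differentiableOn
  exact exists_log_of_isSimplyConnected E.isOpen (JordanDomain.isSimplyConnected_holds E)
    hd.continuousOn fun z hz ↦ ConformalEquiv.deriv_ne_zero_holds Ψ E.isOpen hz

/-! ### Boundary limits of `log Ψ'` at flat boundary points (Schwarz reflection) -/

/-- **Boundary limit of `log Ψ'` at a flat boundary point.**  Let `U` be open, `Ψ : U → ℍ` a
conformal equivalence, and `x` a point at which `U` is the upper half-disc
(`U ∩ B(x, r) = {im > im x} ∩ B(x, r)`) such that `Ψ` has a real boundary value at every point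
`x + t`, `|t| < r`, of the diameter.  Then every continuous logarithm `L` of `Ψ'` on `U` has a
limit at `x` from inside `U`.  Proof: `Ψ(· + x)` extends continuously and with real values to the
diameter, hence holomorphically to `B(0, r)` by the Schwarz reflection principle; the extension
`F` satisfies `F'(0) ≠ 0` (it has positive imaginary part on the upper half-disc), so `F'` has a
continuous logarithm `ℓ` near `0`, and `L(· + x) - ℓ` is continuous with values in `2πiℤ` on the
connected half-disc, hence constant. Pommerenke (1992), §2.1; Conway, *Functions of One Complex
Variable I*, IX.1.1. [folklore] -/
theorem exists_tendsto_log_deriv_of_flat {U : Set ℂ} (Ψ : ConformalEquiv U upperHalfPlaneSet)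
    {x : ℂ} {r : ℝ} (hr : 0 < r)
    (hflat : U ∩ ball x r = {z : ℂ | x.im < z.im} ∩ ball x r)
    (hbv : ∀ t : ℝ, |t| < r → ∃ σ : ℝ, Tendsto Ψ (𝓝[U] (x + t)) (𝓝 (σ : ℂ)))
    {L : ℂ → ℂ} (hL : ContinuousOn L U) (hexp : ∀ z ∈ U, exp (L z) = deriv Ψ z) :
    ∃ Lx : ℂ, Tendsto L (𝓝[U] x) (𝓝 Lx) := by
  -- the half-disc `W` and the translated map `g = Ψ (· + x)`
  set W : Set ℂ := upperHalfPlaneSet ∩ ball (0 : ℂ) r with hW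
  have hWo : IsOpen W := isOpen_upperHalfPlaneSet.inter isOpen_ball
  have hTW : ∀ z ∈ W, z + x ∈ U := by
    intro z hz
    have h1 : 0 < z.im := hz.1
    have : z + x ∈ {z : ℂ | x.im < z.im} ∩ ball x r := by
      refine ⟨?_, ?_⟩
      · show x.im < (z + x).im
        rw [add_im]; linarith
      · rw [mem_ball, dist_eq_norm, add_sub_cancel_right]; exact mem_ball_zero_iff.1 hz.2
    rw [← hflat] at this
    exact this.1
  set g : ℂ → ℂ := fun z => Ψ (z + x) with hg
  have hgd : DifferentiableOn ℂ g W :=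
    Ψ.differentiableOn_coe.comp (differentiableOn_id.add_const x) fun z hz => hTW z hz
  have hgim : ∀ z ∈ W, 0 < (g z).im := fun z hz => Ψ.mapsTo (hTW z hz)
  -- boundary values of `g` on the diameter
  have hgbv : ∀ t : ℝ, |t| < r → ∃ σ : ℝ, Tendsto g (𝓝[W] (t : ℂ)) (𝓝 (σ : ℂ)) := by
    intro t ht
    obtain ⟨σ, hσ⟩ := hbv t ht
    refine ⟨σ, ?_⟩
    have h1 : Tendsto (fun z : ℂ => z + x) (𝓝[W] (t : ℂ)) (𝓝[U] (x + t)) := by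
      refine tendsto_nhdsWithin_iff.2 ⟨?_, eventually_nhdsWithin_of_forall fun z hz => hTW z hz⟩
      have hc : Continuous fun z : ℂ => z + x := continuous_id.add continuous_const
      have h := (hc.tendsto (t : ℂ)).mono_left (nhdsWithin_le_nhds (s := W))
      rwa [add_comm (t : ℂ) x] at h
    exact hσ.comp h1
  -- the continuous extension `G` of `g` to the closed half-disc
  set G : ℂ → ℂ := extendFrom W g with hG
  have hGW : ∀ z ∈ W, G z = g z := extendFrom_extends hgd.continuousOn
  have hGt : ∀ t : ℝ, |t| < r → ∃ σ : ℝ, G t = σ := by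
    intro t ht
    obtain ⟨σ, hσ⟩ := hgbv t ht
    exact ⟨σ, extendFrom_eq (ofReal_mem_closure_inter_ball ht) hσ⟩
  have habs : ∀ z ∈ ball (0 : ℂ) r, |z.re| < r := fun z hz =>
    (abs_re_le_norm z).trans_lt (mem_ball_zero_iff.1 hz)
  have hre : ∀ z : ℂ, z.im = 0 → ((z.re : ℝ) : ℂ) = z := fun z hz =>
    Complex.ext (by simp) (by simp [hz])
  have hBsub : ball (0 : ℂ) r ∩ {z : ℂ | 0 ≤ z.im} ⊆ closure W := by
    rintro z ⟨hz, hzim⟩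
    rcases (show 0 ≤ z.im from hzim).lt_or_eq with hlt | heq
    · exact subset_closure ⟨hlt, hz⟩
    · rw [← hre z heq.symm]
      exact ofReal_mem_closure_inter_ball (habs z hz)
  have hGc : ContinuousOn G (ball (0 : ℂ) r ∩ {z : ℂ | 0 ≤ z.im}) := by
    refine continuousOn_extendFrom hBsub ?_
    rintro z ⟨hz, hzim⟩
    rcases (show 0 ≤ z.im from hzim).lt_or_eq with hlt | heq
    · exact ⟨g z, hgd.continuousOn z ⟨hlt, hz⟩⟩
    · obtain ⟨σ, hσ⟩ := hgbv z.re (habs z hz)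
      rw [hre z heq.symm] at hσ
      exact ⟨σ, hσ⟩
  -- Schwarz reflection: `F` holomorphic on `B(0, r)`, `F = g` on `W`
  set F : ℂ → ℂ := Complex.schwarzReflection G with hF
  have hFd : DifferentiableOn ℂ F (ball (0 : ℂ) r) := by
    refine Complex.differentiableOn_schwarzReflection isOpen_ball (fun z hz => ?_) hGc ?_ ?_
    · simpa [mem_ball_zero_iff] using hz
    · have hset : ball (0 : ℂ) r ∩ {z : ℂ | 0 < z.im} = W := by
        ext z
        simp only [hW, mem_inter_iff, mem_setOf_eq, upperHalfPlaneSet, and_comm]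
      rw [hset]
      exact hgd.congr fun z hz => hGW z hz
    · intro z hz hzim
      obtain ⟨σ, hσ⟩ := hGt z.re (habs z hz)
      rw [← hre z hzim, hσ, conj_ofReal]
  have hFW : ∀ z ∈ W, F z = g z := fun z hz => by
    rw [hF, Complex.schwarzReflection_of_nonneg (le_of_lt hz.1), hGW z hz]
  -- `F'(0) ≠ 0`
  obtain ⟨σ₀, hσ₀⟩ := hGt 0 (by simpa using hr)
  have hF0 : F 0 = σ₀ := by
    rw [hF, ← ofReal_zero, Complex.schwarzReflection_ofReal, hσ₀]
  have hF'0 : deriv F 0 ≠ 0 := by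
    have h := SchwarzReflection.deriv_ne_zero_of_im_pos hr (F := fun z => F z - σ₀)
      (hFd.sub_const _) (by rw [hF0, sub_self]) (fun z hz => ?_)
    · rwa [deriv_sub_const] at h
    · rw [sub_im, ofReal_im, sub_zero, hFW z hz]; exact hgim z hz
  -- `F'` is continuous on the ball and nonzero near `0`
  have hF'c : ContinuousOn (deriv F) (ball (0 : ℂ) r) :=
    ((hFd.analyticOnNhd isOpen_ball).deriv).continuousOn
  obtain ⟨r₁, hr₁, hr₁r, hne⟩ : ∃ r₁, 0 < r₁ ∧ r₁ ≤ r ∧ ∀ z ∈ ball (0 : ℂ) r₁, deriv F z ≠ 0 := by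
    have hca : ContinuousAt (deriv F) 0 := hF'c.continuousAt (ball_mem_nhds 0 hr)
    obtain ⟨r₁, hr₁, h⟩ := Metric.eventually_nhds_iff_ball.1 (hca.eventually_ne hF'0)
    exact ⟨min r₁ r, lt_min hr₁ hr, min_le_right _ _,
      fun z hz => h z (ball_subset_ball (min_le_left _ _) hz)⟩
  -- a continuous logarithm `ℓ` of `F'` on `B(0, r₁)`
  obtain ⟨ℓ, hℓc, hℓe⟩ := exists_log_of_isSimplyConnected isOpen_ball (isSimplyConnected_ball 0 hr₁)
    (hF'c.mono (ball_subset_ball hr₁r)) hne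
  -- on the small half-disc `W₁`, `L (z + x) - ℓ z ∈ 2πiℤ` is constant
  set W₁ : Set ℂ := upperHalfPlaneSet ∩ ball (0 : ℂ) r₁ with hW₁
  have hW₁W : W₁ ⊆ W := fun z hz => ⟨hz.1, ball_subset_ball hr₁r hz.2⟩
  have hderiv : ∀ z ∈ W₁, deriv F z = deriv Ψ (z + x) := by
    intro z hz
    have hev : F =ᶠ[𝓝 z] g := by
      filter_upwards [hWo.mem_nhds (hW₁W hz)] with w hw
      exact hFW w hw
    rw [hev.deriv_eq, hg]
    exact deriv_comp_add_const _ _ _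
  have hk : ∀ z ∈ W₁, exp (L (z + x) - ℓ z) = 1 := by
    intro z hz
    have h0 : deriv F z ≠ 0 := hne z hz.2
    rw [exp_sub, hexp _ (hTW z (hW₁W hz)), hℓe z hz.2, ← hderiv z hz, div_self h0]
  have hW₁c : IsPreconnected W₁ :=
    ((convex_halfSpace_im_gt 0).inter (convex_ball (0 : ℂ) r₁)).isPreconnected
  set z₁ : ℂ := I * ((r₁ / 2 : ℝ) : ℂ) with hz₁
  have hz₁W : z₁ ∈ W₁ := by
    refine ⟨?_, ?_⟩
    · show 0 < z₁.im
      simp [hz₁, hr₁]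
    · rw [mem_ball_zero_iff, hz₁, norm_mul, norm_I, one_mul, norm_real,
        Real.norm_of_nonneg (by positivity)]
      linarith
  have hcontk : ContinuousOn (fun z => L (z + x) - ℓ z) W₁ := by
    refine ContinuousOn.sub ?_ (hℓc.mono fun z hz => hz.2)
    exact hL.comp (continuous_id.add continuous_const).continuousOn fun z hz => hTW z (hW₁W hz)
  have hconst : ∀ z ∈ W₁, L (z + x) - ℓ z = L (z₁ + x) - ℓ z₁ := by
    intro z hz
    refine hW₁c.constant_of_mapsTo (T := ((AddSubgroup.zmultiples (2 * π * I) : AddSubgroup ℂ) :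
      Set ℂ)) ?_ hcontk ?_ hz hz₁W
    · exact SetLike.isDiscrete_iff_discreteTopology.2 inferInstance
    · intro w hw
      obtain ⟨n, hn⟩ := Complex.exp_eq_one_iff.1 (hk w hw)
      show L (w + x) - ℓ w ∈ _
      rw [hn]
      exact ⟨n, by simp [zsmul_eq_mul]⟩
  -- the limit
  refine ⟨ℓ 0 + (L (z₁ + x) - ℓ z₁), ?_⟩
  have h1 : Tendsto (fun z => L (z + x)) (𝓝[W₁] 0) (𝓝 (ℓ 0 + (L (z₁ + x) - ℓ z₁))) := by
    have hℓ0 : Tendsto ℓ (𝓝[W₁] 0) (𝓝 (ℓ 0)) :=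
      ((hℓc.continuousAt (ball_mem_nhds 0 hr₁)).tendsto).mono_left nhdsWithin_le_nhds
    refine (hℓ0.add_const (L (z₁ + x) - ℓ z₁)).congr' ?_
    filter_upwards [self_mem_nhdsWithin] with z hz
    rw [← hconst z hz]
    ring
  have h2 : Tendsto (fun z => z - x) (𝓝[U] x) (𝓝[W₁] 0) := by
    refine tendsto_nhdsWithin_iff.2 ⟨?_, ?_⟩
    · have hc : Continuous fun z : ℂ => z - x := continuous_id.sub continuous_const
      simpa using (hc.tendsto x).mono_left (nhdsWithin_le_nhds (s := U))
    · filter_upwards [self_mem_nhdsWithin, mem_nhdsWithin_of_mem_nhds (ball_mem_nhds x hr₁)]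
        with z hzU hzb
      have hz : z ∈ U ∩ ball x r := ⟨hzU, ball_subset_ball hr₁r hzb⟩
      rw [hflat] at hz
      have him : x.im < z.im := hz.1
      refine ⟨?_, ?_⟩
      · show 0 < (z - x).im
        rw [sub_im]; linarith
      · rw [mem_ball_zero_iff, ← dist_eq_norm]; exact hzb
  refine (h1.comp h2).congr fun z => ?_
  simp only [Function.comp_apply, sub_add_cancel]

/-! ### Registered form (sub-goal of `stub_restrictionCocycle`) -/

/-- **Registered sub-goal `stub_restrictionCocycle_flatLogDeriv`** (crux item
stmt-CriticalPhenomena-10472, line `floor-ratio-restriction-bootstrap`, mechanism stub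
`stub_restrictionCocycle`): the boundary limit of `log Ψ'` at a flat boundary point where `Ψ` has
real boundary values along the diameter (`exists_tendsto_log_deriv_of_flat`). [folklore] -/
theorem stub_restrictionCocycle_flatLogDeriv : ∀ (U : Set ℂ) (Ψ : ConformalEquiv U upperHalfPlaneSet)
    (x : ℂ) (r : ℝ), 0 < r → U ∩ ball x r = {z : ℂ | x.im < z.im} ∩ ball x r →
    (∀ t : ℝ, |t| < r → ∃ σ : ℝ, Tendsto Ψ (𝓝[U] (x + t)) (𝓝 (σ : ℂ))) →
    ∀ (L : ℂ → ℂ), ContinuousOn L U → (∀ z ∈ U, Complex.exp (L z) = deriv Ψ z) →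
    ∃ Lx : ℂ, Tendsto L (𝓝[U] x) (𝓝 Lx) :=
  fun _ Ψ _ _ hr hflat hbv _ hL hexp => exists_tendsto_log_deriv_of_flat Ψ hr hflat hbv hL hexp

end Summit.CriticalPhenomena.SAWScalingLimit.Theorems.ObservableToSLE.FloorRatio

end
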